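import Literature.AlgebraicGeometry.GroupSchemes.GroupSchemeKernelAlg
import Literature.AlgebraicGeometry.GroupSchemes.CartierDualAnnihilator
import Literature.RingTheory.HopfAlgebra.FreeOverSubbialgebra
import HarnessLib

/-!
# The rank clause `rk H^⊥ · rk H = rk G` of the annihilator, and `rk (Ker φ) · rk G₂ = rk G₁` for finite group schemes over a field

Layer `Literature/AlgebraicGeometry/GroupSchemes`, namespace `Literature.AlgebraicGeometry.GroupSchemes.AffineGroupScheme` (continues ★
`CartierDualAnnihilator` p845459 — `annihilator j = Ker (j^D)` —, ★ `GroupSchemeKernelAlg` p845691 — `Γ(Ker φ) ≅ Γ(G₁) ⧸ φ^*(Γ(G₂)⁺)·Γ(G₁)` —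
and A-p17 (g25)'s ★ `RingTheory/HopfAlgebra/FreeOverSubbialgebra` p845589 — `dimₖ A · dimₖ (B ⧸ f(A⁺)B) = dimₖ B` for an injective bialgebra
map `f : A → B` into a finite commutative Hopf algebra over a field).  THEOREMS ONLY (no definition, no instance, no notation, no named fact,
no `sorry`).  Cell `hodgecm-mathlib` (D-0151), programme P6 «MOD», organ (a-rk) of B-p04 (g37) = the RANK CLAUSE of rider (a) flagged ⚠️
16:23:39Z, input (W14) delivered by A-p17 (g25) (LEAD F0P6-plan (g0) M-16d (3)).  Count-neutral Mathlib-side capital: HC_CM is proved only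
modulo the printed citations until rung 0 closes; nothing here bears on it.

THE PRINT ([Tate1997FiniteFlatGroupSchemes] (3.7)–(3.8): the order is multiplicative in short exact sequences and `(G′)^D`, `(G″)^D` have the
orders of `G′`, `G″`; [Waterhouse1979] §2.1 (kernels: `A ⧸ I_B A`), §14.1 Theorem (a commutative Hopf algebra is faithfully flat ∕ free over
a Hopf subalgebra); [Montgomery1993Hopf] Thm 3.1.5 (Nichols–Zoeller, finite case)).  THEN, for affine group objects of `SchemeOver R`:

* §1 (over a field `k`, `Γ(G₁)` finite) **`finrank_alg_ker_mul_finrank : rk Γ(Ker φ) · rk Γ(G₂) = rk Γ(G₁)`** for a homomorphism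
  `φ : G₁ ⟶ G₂` with `Γ(φ)` INJECTIVE (`φ` dominant), and Lagrange `finrank_alg_dvd_of_injective_comap : rk Γ(G₂) ∣ rk Γ(G₁)`
  (★ `finrank_mul_finrank_of_injective` at ★ `Alg.comapBialgHom φ`, ★ `finrank_alg_ker_eq`);
* §2 for a closed immersion `j : H ↪ G`: `Γ(j)` is surjective (`surjective_comap_of_isClosedImmersion`) and the transpose
  `Γ(H)^* → Γ(G)^*` is injective (`injective_transpose_of_isClosedImmersion`);
* §3 (any `R`, `Γ(H)` finite free) the transport of ★ `ker_appTop_kerι_eq` through `Γ(G^D) ≃ Γ(G)^*` (★ `algCartierDualEquiv`):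
  `algCartierDualEquiv_comp_comap_cartierDualMap` (`e_G ∘ Γ(j^D) = (Γ(j))^* ∘ e_H`), `map_algCartierDualEquiv_ker_counit`,
  **`exists_algEquiv_quotient_alg_annihilator : Γ(G)^* ⧸ (Γ(H)^*)⁺·Γ(G)^* ≃ₐ[R] Γ(H^⊥)`**, `finrank_alg_annihilator_eq`;
* §4 HEAD (over a field `k`, `H`, `G` finite commutative, `j : H ↪ G` a closed subgroup) **`finrank_alg_annihilator_mul_finrank :
  rk Γ(H^⊥) · rk Γ(H) = rk Γ(G)`**, with `finrank_alg_dvd_of_isClosedImmersion : rk Γ(H) ∣ rk Γ(G)` (Lagrange for closed subgroups of a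
  finite commutative `G`), `finrank_alg_annihilator_dvd`, `finrank_alg_pos`, `finrank_alg_annihilator_eq_div : rk Γ(H^⊥) = rk Γ(G) ∕ rk Γ(H)`.

## References
* [Tate1997FiniteFlatGroupSchemes] J. Tate, *Finite flat group schemes*, in: Modular Forms and Fermat's Last Theorem (1997) — (3.7), §(3.8) p. 145.
* [Waterhouse1979] W. C. Waterhouse, *Introduction to Affine Group Schemes*, GTM 66 (1979) — §2.1 p. 14, §14.1 Theorem.
* [Montgomery1993Hopf] S. Montgomery, *Hopf Algebras and Their Actions on Rings*, CBMS 82 (1993) — Theorem 3.1.5, Corollary 3.2.1 (p. 30).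
-/

set_option autoImplicit false

-- Mathlib's `Over`/`Scheme` APIs are stated across semireducible wrappers (as in the ★ `GroupSchemes/*` files).
set_option backward.isDefEq.respectTransparency false

universe u

open CategoryTheory CategoryTheory.Limits AlgebraicGeometry MonoidalCategory CartesianMonoidalCategory WithConv

noncomputable section

namespace Literature.AlgebraicGeometry.GroupSchemes

namespace AffineGroupScheme

open scoped MonObj

open Literature.AlgebraicGeometry.Motives Literature.NumberTheory.DiophantineGeometry Literature.RingTheory.HopfAlgebra GroupSchemeKernel

/-! ## §1 `rk Γ(Ker φ) · rk Γ(G₂) = rk Γ(G₁)` when `Γ(φ)` is injective (finite group schemes over a field) -/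

section KerRank

variable {k : Type u} [Field k] {G₁ G₂ : SchemeOver k} [GrpObj G₁] [GrpObj G₂] [IsAffine G₁.left] [IsAffine G₂.left] (φ : G₁ ⟶ G₂)
  [IsMonHom φ] [Module.Finite k (Alg G₁)]

/-- **`rk Γ(Ker φ) · rk Γ(G₂) = rk Γ(G₁)`** for a homomorphism `φ : G₁ → G₂` of affine group schemes over a field `k` with `Γ(G₁)` finite and
`Γ(φ) : Γ(G₂) → Γ(G₁)` INJECTIVE: `Γ(G₁)` is free over the sub-bialgebra `Γ(G₂)` with `Γ(G₁) ⧸ Γ(G₂)⁺Γ(G₁) = Γ(Ker φ)` (★ `finrank_mul_finrank_of_injective`,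
★ `finrank_alg_ker_eq`). [cite: Waterhouse1979, §14.1 Theorem; §2.1 p. 14] [cite: Montgomery1993Hopf, Theorem 3.1.5 (p. 30)]
[cite: Tate1997FiniteFlatGroupSchemes, (3.7)] -/
theorem finrank_alg_ker_mul_finrank (hinj : Function.Injective (Alg.comap φ)) :
    Module.finrank k (Alg (ker φ)) * Module.finrank k (Alg G₂) = Module.finrank k (Alg G₁) := by
  rw [finrank_alg_ker_eq φ, mul_comm]
  exact FreeOverSubbialgebra.finrank_mul_finrank_of_injective (Alg.comapBialgHom φ) hinj

/-- **LAGRANGE for dominant homomorphisms: `rk Γ(G₂) ∣ rk Γ(G₁)`** when `Γ(φ)` is injective. [cite: Waterhouse1979, §14.1 Theorem]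
[cite: Montgomery1993Hopf, Corollary 3.2.1 (p. 30)] -/
theorem finrank_alg_dvd_of_injective_comap (hinj : Function.Injective (Alg.comap φ)) :
    Module.finrank k (Alg G₂) ∣ Module.finrank k (Alg G₁) :=
  Dvd.intro_left _ (finrank_alg_ker_mul_finrank φ hinj)

end KerRank

/-! ## §2 A closed immersion `j : H ↪ G`: `Γ(j)` is surjective, its transpose is injective -/

section Closed

variable {R : Type u} [CommRing R] {H G : SchemeOver R} [IsAffine H.left] [IsAffine G.left] (j : H ⟶ G)

/-- **`Γ(j) : Γ(G) → Γ(H)` is surjective for a closed immersion `j` into an affine `G`** (★ `surjective_ptEquiv_isoSpecOver_inv_comp` read through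
★ `comap_eq_ptEquiv`). [cite: Waterhouse1979, §2.1 p. 14] -/
theorem surjective_comap_of_isClosedImmersion [IsClosedImmersion j.left] : Function.Surjective (Alg.comap j) := by
  rw [comap_eq_ptEquiv]
  exact surjective_ptEquiv_isoSpecOver_inv_comp j

variable [GrpObj H] [IsCommMonObj H] [GrpObj G] [IsCommMonObj G] [IsMonHom j]

/-- **The transpose `Γ(H)^* → Γ(G)^*` of `Γ(j)` is injective for a closed immersion `j`** (precomposition with the surjection `Γ(j)`).
[cite: Tate1997FiniteFlatGroupSchemes, §(3.8) p. 145] -/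
theorem injective_transpose_of_isClosedImmersion [IsClosedImmersion j.left] : Function.Injective (DualAlg.transpose j) := by
  intro x y h
  apply ofConv_injective
  apply LinearMap.ext
  intro b
  obtain ⟨a, rfl⟩ := surjective_comap_of_isClosedImmersion j b
  rw [← DualAlg.transpose_apply_apply, ← DualAlg.transpose_apply_apply, h]

end Closed

/-! ## §3 `Γ(H^⊥) ≅ Γ(G)^* ⧸ (Γ(H)^*)⁺ · Γ(G)^*` (any base ring) -/

section Transport

variable {R : Type u} [CommRing R] {H G : SchemeOver R}
  [GrpObj H] [IsCommMonObj H] [IsAffine H.left] [Module.Free R (Alg H)] [Module.Finite R (Alg H)]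
  [GrpObj G] [IsCommMonObj G] [IsAffine G.left] (j : H ⟶ G) [IsMonHom j]

omit [GrpObj G] [IsCommMonObj G] in
/-- The coordinates of the identity point of `G^D = Spec Γ(G)^*` are `e⁻¹ : Γ(G)^* ≅ Γ(G^D)`. [cite: Tate1997FiniteFlatGroupSchemes, §(3.8) p. 145] -/
theorem coord_id_cartierDual [GrpObj G] [IsCommMonObj G] :
    coord (𝟙 (cartierDual G)) = (algCartierDualEquiv G).symm.toAlgHom := by
  change (Alg.comap (𝟙 (specOver R (DualAlg G)))).comp (algSpecOverEquiv (DualAlg G)).symm.toAlgHom = _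
  rw [Alg.comap_id, AlgHom.id_comp]
  rfl

omit [Module.Free R (Alg H)] [Module.Finite R (Alg H)] in
/-- **`e_G ∘ Γ(j^D) = (Γ(j))^* ∘ e_H`**: through `e := algCartierDualEquiv : Γ(·^D) ≃ Γ(·)^*`, the algebra map of `j^D : G^D → H^D` is the
transpose of `Γ(j)` (★ `coord_comp_cartierDualMap` at the identity point). [cite: Tate1997FiniteFlatGroupSchemes, §(3.8) p. 145] -/
theorem algCartierDualEquiv_comp_comap_cartierDualMap :
    (algCartierDualEquiv G).toAlgHom.comp (Alg.comap (cartierDualMap j)) = (DualAlg.transpose j).comp (algCartierDualEquiv H).toAlgHom := by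
  have h : (Alg.comap (cartierDualMap j)).comp (algCartierDualEquiv H).symm.toAlgHom =
      (algCartierDualEquiv G).symm.toAlgHom.comp (DualAlg.transpose j) := by
    rw [← coord_id_cartierDual, ← coord_comp, Category.comp_id, ← coord_id_cartierDual, ← coord_comp_cartierDualMap, Category.id_comp]
  apply AlgHom.ext
  intro a
  obtain ⟨b, rfl⟩ := (algCartierDualEquiv H).symm.surjective a
  have hb : Alg.comap (cartierDualMap j) ((algCartierDualEquiv H).symm b) = (algCartierDualEquiv G).symm (DualAlg.transpose j b) :=
    AlgHom.congr_fun h b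
  change algCartierDualEquiv G (Alg.comap (cartierDualMap j) ((algCartierDualEquiv H).symm b)) =
    DualAlg.transpose j (algCartierDualEquiv H ((algCartierDualEquiv H).symm b))
  rw [hb, AlgEquiv.apply_symm_apply, AlgEquiv.apply_symm_apply]

omit [GrpObj G] [IsCommMonObj G] [IsAffine G.left] [IsMonHom j] in
/-- **`e_H` matches the counits**: `ε_{Γ(H)^*} (e_H x) = ε_{Γ(H^D)} x` (★ `counitAlgHom_comp_algSpecOverEquiv`). [cite: Tate1997FiniteFlatGroupSchemes, §(3.8) p. 145] -/
theorem counit_algCartierDualEquiv_apply (x : Alg (cartierDual H)) :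
    Bialgebra.counitAlgHom R (DualAlg H) (algCartierDualEquiv H x) = Bialgebra.counitAlgHom R (Alg (cartierDual H)) x := by
  haveI : IsAffine (specOver R (DualAlg H)).left := isAffine_specOver_left (DualAlg H)
  exact AlgHom.congr_fun (counitAlgHom_comp_algSpecOverEquiv R (DualAlg H)) x

omit [GrpObj G] [IsCommMonObj G] [IsAffine G.left] [IsMonHom j] in
/-- **`e_H (Γ(H^D)⁺) = (Γ(H)^*)⁺`**: the augmentation ideals correspond. [cite: Tate1997FiniteFlatGroupSchemes, §(3.8) p. 145] -/
theorem map_algCartierDualEquiv_ker_counit :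
    (RingHom.ker (Bialgebra.counitAlgHom R (Alg (cartierDual H)))).map (algCartierDualEquiv H : Alg (cartierDual H) →+* DualAlg H) =
      RingHom.ker (Bialgebra.counitAlgHom R (DualAlg H)) := by
  rw [show (algCartierDualEquiv H : Alg (cartierDual H) →+* DualAlg H) = ((algCartierDualEquiv H : Alg (cartierDual H) ≃+* DualAlg H) :
      Alg (cartierDual H) →+* DualAlg H) from rfl, Ideal.map_comap_of_equiv]
  ext y
  rw [Ideal.mem_comap, RingHom.mem_ker, RingHom.mem_ker]
  change Bialgebra.counitAlgHom R (Alg (cartierDual H)) ((algCartierDualEquiv H).symm y) = 0 ↔ _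
  rw [← counit_algCartierDualEquiv_apply, AlgEquiv.apply_symm_apply]

/-- **`e_G (Γ(j^D)(Γ(H^D)⁺) · Γ(G^D)) = (Γ(j))^*((Γ(H)^*)⁺) · Γ(G)^*`**: the ideal of `H^⊥ = Ker j^D` (★ `ker_appTop_kerι_eq`) corresponds to the
ideal `f(A⁺)B` of ★ `FreeOverSubbialgebra` for `f = (Γ(j))^* : A = Γ(H)^* → B = Γ(G)^*`. [cite: Tate1997FiniteFlatGroupSchemes, §(3.8) p. 145] -/
theorem map_algCartierDualEquiv_map_ker_counit :
    ((RingHom.ker (Bialgebra.counitAlgHom R (Alg (cartierDual H)))).map (Alg.comap (cartierDualMap j))).map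
        (algCartierDualEquiv G : Alg (cartierDual G) →+* DualAlg G) =
      (RingHom.ker (Bialgebra.counitAlgHom R (DualAlg H))).map (DualAlg.transpose j) := by
  rw [← Ideal.map_coe (Alg.comap (cartierDualMap j)), Ideal.map_map,
    show (algCartierDualEquiv G : Alg (cartierDual G) →+* DualAlg G).comp (Alg.comap (cartierDualMap j) : Alg (cartierDual H) →+* Alg (cartierDual G)) =
      (DualAlg.transpose j : DualAlg H →+* DualAlg G).comp (algCartierDualEquiv H : Alg (cartierDual H) →+* DualAlg H) from
      RingHom.ext (AlgHom.congr_fun (algCartierDualEquiv_comp_comap_cartierDualMap j)),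
    ← Ideal.map_map, map_algCartierDualEquiv_ker_counit, Ideal.map_coe]

/-- **`Γ(G)^* ⧸ (Γ(j))^*((Γ(H)^*)⁺) · Γ(G)^* ≃ₐ[R] Γ(H^⊥)`** — the coordinate ring of the annihilator is the quotient of the dual Hopf algebra of
`G` by the augmentation ideal of the dual Hopf algebra of `H` (★ `exists_algEquiv_quotient_alg_ker` at `j^D`, transported along ★
`algCartierDualEquiv`, Mathlib `Ideal.quotientEquivAlg`). [cite: Tate1997FiniteFlatGroupSchemes, §(3.8) p. 145] [cite: Waterhouse1979, §2.1 p. 14] -/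
theorem exists_algEquiv_quotient_alg_annihilator :
    ∃ _ : (DualAlg G ⧸ (RingHom.ker (Bialgebra.counitAlgHom R (DualAlg H))).map (DualAlg.transpose j)) ≃ₐ[R] Alg (annihilator j), True := by
  obtain ⟨e₀, -⟩ := exists_algEquiv_quotient_alg_ker (cartierDualMap j)
  exact ⟨(Ideal.quotientEquivAlg _ _ (algCartierDualEquiv G) (map_algCartierDualEquiv_map_ker_counit j).symm).symm.trans e₀, trivial⟩

/-- **`rk_R Γ(H^⊥) = rk_R (Γ(G)^* ⧸ (Γ(j))^*((Γ(H)^*)⁺) · Γ(G)^*)`.** [cite: Tate1997FiniteFlatGroupSchemes, §(3.8) p. 145] -/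
theorem finrank_alg_annihilator_eq :
    Module.finrank R (Alg (annihilator j)) =
      Module.finrank R (DualAlg G ⧸ (RingHom.ker (Bialgebra.counitAlgHom R (DualAlg H))).map (DualAlg.transpose j)) := by
  obtain ⟨e, -⟩ := exists_algEquiv_quotient_alg_annihilator j
  exact e.toLinearEquiv.finrank_eq.symm

end Transport

/-! ## §4 HEAD: `rk H^⊥ · rk H = rk G` over a field -/

section Field

variable {k : Type u} [Field k] {H G : SchemeOver k}
  [GrpObj H] [IsCommMonObj H] [IsAffine H.left] [Module.Finite k (Alg H)]
  [GrpObj G] [IsCommMonObj G] [IsAffine G.left] [Module.Finite k (Alg G)] (j : H ⟶ G) [IsMonHom j] [IsClosedImmersion j.left]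

/-- **HEAD — THE RANK CLAUSE `rk Γ(H^⊥) · rk Γ(H) = rk Γ(G)`** for a closed subgroup scheme `j : H ↪ G` of a finite commutative group scheme
`G` over a field `k` ([Tate1997FiniteFlatGroupSchemes] (3.7)–(3.8): `H^⊥ = (G ⧸ H)^D` has order `|G| ⁄ |H|`): ★ `finrank_mul_finrank_of_injective`
(A-p17 (g25), Nichols–Zoeller ∕ Waterhouse 14.1) for the injective bialgebra map `(Γ(j))^* : Γ(H)^* → Γ(G)^*` (§2), whose quotient
`Γ(G)^* ⧸ (Γ(H)^*)⁺Γ(G)^*` is `Γ(H^⊥)` (§3), and `rk Γ(·)^* = rk Γ(·)` (★ `DualAlg.finrank_eq`). [cite: Tate1997FiniteFlatGroupSchemes, §(3.8) p. 145]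
[cite: Waterhouse1979, §14.1 Theorem] [cite: Montgomery1993Hopf, Theorem 3.1.5 (p. 30)] -/
theorem finrank_alg_annihilator_mul_finrank :
    Module.finrank k (Alg (annihilator j)) * Module.finrank k (Alg H) = Module.finrank k (Alg G) := by
  rw [finrank_alg_annihilator_eq j, ← DualAlg.finrank_eq H, ← DualAlg.finrank_eq G, mul_comm]
  exact FreeOverSubbialgebra.finrank_mul_finrank_of_injective (DualAlg.transposeBialgHom j) (injective_transpose_of_isClosedImmersion j)

include j in
/-- **LAGRANGE for closed subgroups of a finite commutative group scheme: `rk Γ(H) ∣ rk Γ(G)`.** [cite: Tate1997FiniteFlatGroupSchemes, (3.7)]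
[cite: Waterhouse1979, §14.1 Theorem] -/
theorem finrank_alg_dvd_of_isClosedImmersion : Module.finrank k (Alg H) ∣ Module.finrank k (Alg G) :=
  Dvd.intro_left _ (finrank_alg_annihilator_mul_finrank j)

/-- `rk Γ(H^⊥) ∣ rk Γ(G)`. [cite: Tate1997FiniteFlatGroupSchemes, §(3.8) p. 145] -/
theorem finrank_alg_annihilator_dvd : Module.finrank k (Alg (annihilator j)) ∣ Module.finrank k (Alg G) :=
  Dvd.intro _ (finrank_alg_annihilator_mul_finrank j)

omit [IsCommMonObj H] [Module.Finite k (Alg H)] in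
/-- A group scheme over a field has positive rank (its coordinate ring has the `k`-point `ε`, so it is a nonzero `k`-space), for `Γ(H)` finite.
[cite: Tate1997FiniteFlatGroupSchemes, (3.7)] -/
theorem finrank_alg_pos [Module.Finite k (Alg H)] : 0 < Module.finrank k (Alg H) :=
  haveI : Nontrivial (Alg H) := (Bialgebra.counitAlgHom k (Alg H)).toRingHom.domain_nontrivial
  Module.finrank_pos

/-- **`rk Γ(H^⊥) = rk Γ(G) ⁄ rk Γ(H)`.** [cite: Tate1997FiniteFlatGroupSchemes, §(3.8) p. 145] -/
theorem finrank_alg_annihilator_eq_div :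
    Module.finrank k (Alg (annihilator j)) = Module.finrank k (Alg G) / Module.finrank k (Alg H) := by
  rw [← finrank_alg_annihilator_mul_finrank j, Nat.mul_div_cancel _ (finrank_alg_pos (H := H))]

end Field

end AffineGroupScheme

end Literature.AlgebraicGeometry.GroupSchemes

end
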